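import Summits.BirchSwinnertonDyer.BirchSwinnertonDyer.Theses.PAdicOrderV2
import Summits.BirchSwinnertonDyer.BirchSwinnertonDyer.Theorems.PAdicOrderV2PAdicOrderThesisR2StubUBRank0

/-! Scratch: the five split children of `PAdicOrderThesisR2` rendered as the gate would (route
namespace, route-file spelling), and the glue-by check: the LANDED theorem
`padicOrderThesisR2_of_sandwich` (p96594) has type `C₁ → C₂ → C₃ → C₄ → C₅ → X` up to unfolding. -/

set_option linter.dupNamespace false

namespace Summit.BirchSwinnertonDyer.BirchSwinnertonDyer.Theses.PAdicOrderV2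

open scoped BigOperators Topology Manifold Classical MeasureTheory ProbabilityTheory Matrix InnerProductSpace ComplexConjugate ContinuousMap
open Filter Set Function TopologicalSpace MeasureTheory
open Literature

def PAdicOrderModularity : Prop :=
  ∀ (W : WeierstrassCurve ℚ) [W.IsElliptic] [NeZero (W.conductorNorm ℤ)], ∃ f : CuspForm (CongruenceSubgroup.Gamma0 (W.conductorNorm ℤ)) 2, Literature.NumberTheory.EllipticCurves.ModularForms.IsNewformOf W f

def PAdicOrderKatoSideR2Child : Prop :=
  ∀ (W : WeierstrassCurve ℚ) [W.IsElliptic] [W.IsGloballyMinimal] (p : ℕ) [Fact p.Prime], p ≠ 2 → Literature.NumberTheory.EllipticCurves.IsOrdinaryAt W p → ∀ {N : ℕ} [NeZero N] (f : CuspForm (CongruenceSubgroup.Gamma0 N) 2), Literature.NumberTheory.EllipticCurves.ModularForms.IsNewformOf W f → (W.mordellWeilRank : ℕ∞) ≤ (Literature.NumberTheory.EllipticCurves.padicLFunction f (Literature.NumberTheory.EllipticCurves.unitRoot W p : ℚ_[p])).order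

def PAdicOrderOnePrimeUB : Prop :=
  ∀ (W : WeierstrassCurve ℚ) [W.IsElliptic] [W.IsGloballyMinimal], 0 < W.analyticRank → ∃ (p : ℕ) (_ : Fact p.Prime), 5 ≤ p ∧ Literature.NumberTheory.EllipticCurves.IsOrdinaryAt W p ∧ ∀ {N : ℕ} [NeZero N] (f : CuspForm (CongruenceSubgroup.Gamma0 N) 2), Literature.NumberTheory.EllipticCurves.ModularForms.IsNewformOf W f → (Literature.NumberTheory.EllipticCurves.padicLFunction f (Literature.NumberTheory.EllipticCurves.unitRoot W p : ℚ_[p])).order ≤ (W.analyticRank : ℕ∞)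

def PAdicOrderLBRankOne : Prop :=
  ∀ (W : WeierstrassCurve ℚ) [W.IsElliptic] [W.IsGloballyMinimal], W.analyticRank = 1 → 1 ≤ W.mordellWeilRank

def PAdicOrderLBHigherRank : Prop :=
  ∀ (W : WeierstrassCurve ℚ) [W.IsElliptic] [W.IsGloballyMinimal], 2 ≤ W.analyticRank → W.analyticRank ≤ W.mordellWeilRank

/-- the existing route decl and the re-asked child statement agree syntactically -/
example : PAdicOrderKatoSideR2Child = PAdicOrderKatoSideR2 := rfl

/-- glue-by check -/
example : PAdicOrderModularity → PAdicOrderKatoSideR2 → PAdicOrderOnePrimeUB → PAdicOrderLBRankOne →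
    PAdicOrderLBHigherRank → PAdicOrderThesisR2 :=
  _root_.Summit.BirchSwinnertonDyer.BirchSwinnertonDyer.Cruxes.PAdicOrderThesisR2.KatoSandwich.padicOrderThesisR2_of_sandwich

/-- glue-by check, tactic form -/
example : PAdicOrderModularity → PAdicOrderKatoSideR2 → PAdicOrderOnePrimeUB → PAdicOrderLBRankOne →
    PAdicOrderLBHigherRank → PAdicOrderThesisR2 := by
  intro h1 h2 h3 h4 h5
  exact _root_.Summit.BirchSwinnertonDyer.BirchSwinnertonDyer.Cruxes.PAdicOrderThesisR2.KatoSandwich.padicOrderThesisR2_of_sandwich h1 h2 h3 h4 h5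

end Summit.BirchSwinnertonDyer.BirchSwinnertonDyer.Theses.PAdicOrderV2
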